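import Summits.ValiantsHypothesis.ValiantsHypothesis.Theorems.SymPencilPerFourOneRowDefectTwoKernel

/-!
# Route `SymPencil` — LAGRANGIAN INVARIANCE AT DEFECT ONE: a maximal isotropic image is invariant
# under every AFFINE kernel direction (`--supports` stmt-ValiantsHypothesis-5674
# `SdcSuperquadratic`; the `(13, 3, 1)` cell of the size-`28` kernel-package table; rung currency
# only — nothing here bears on `VP ≠ VNP`)

`SymPencilLagrangianInvariant.mulVec_mem_range_of_lagrangian` proves `C(v) D⁻¹ (im bL) ⊆ im bL`
for kernel directions `v` when `im bL` is LAGRANGIAN (`|ι'| = 2·rk bL`).  At size `28` the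
`r = 13` cell has `|ι'| = 27 = 2·13 + 1`: the image is only MAXIMAL ISOTROPIC.  **Theorem**
(`mulVec_mem_range_of_affine_defect_one`): if `|ι'| ≤ 2·rk bL + 1` and the kernel direction `v` is
AFFINE (`per_4 (z + s v)` affine in `s` — true for every direction supported on one row or one
column, `…SdcPerFourTwentySeven.affine_of_row / affine_of_col`), then still
`C(v) D⁻¹ (im bL) ⊆ im bL`.  Proof: the cyclic isotropy of an affine kernel direction
(`SymPencilCyclicIsotropy.cyclic_isotropy_of_affine`, as in val-lit-p4 g14's
`…OneRowDefectTwoKernel.exists_invariant_extension`, whose first half is repeated verbatim) makes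
`W = im bL + S·im bL` totally isotropic, so `2·dim W ≤ |ι'| ≤ 2·rk + 1`, `dim W ≤ rk`, `W = im bL`.
Consumer: the `(13, 3, 1)` cell at `m = 28` (`…CellThirteenThreeTwentyEight`, toric kernels are
row/column supported).

Honest framing: a linear-algebra lemma; no cell closes here; `28 ≤ sdc(per_4) ≤ 29` of record,
the crux `SdcSuperquadratic` and `VP ≠ VNP` untouched.  Credit: proof skeleton val-lit-p4 g14.
No definitions, no named facts. [folklore]
-/

noncomputable section

-- single-conjunct layout: Sub = Summit, duplicated namespace component intended
set_option linter.dupNamespace false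

namespace Summit.ValiantsHypothesis.ValiantsHypothesis.Theorems.SymPencilLagrangianInvariantDefectOne

open Matrix Module MvPolynomial
open Literature.Computability.AlgebraicComplexity
open Summit.ValiantsHypothesis.ValiantsHypothesis.Theorems.SymPencilLagrangianKernel
open Summit.ValiantsHypothesis.ValiantsHypothesis.Theorems.SymPencilHomogeneousDropRankCodim
open Summit.ValiantsHypothesis.ValiantsHypothesis.Theorems.SymPencilCyclicIsotropy
open Summit.ValiantsHypothesis.ValiantsHypothesis.Theorems.SymPencilAffineKernelLever
open Summit.ValiantsHypothesis.ValiantsHypothesis.Theorems.SymPencilPerFourOneRowKernel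
open Summit.ValiantsHypothesis.ValiantsHypothesis.Theorems.SymPencilPerFourInnerRankRows

universe u

variable {k : Type u} [Field k] [CharZero k] {ι' : Type*} [Fintype ι'] [DecidableEq ι']

/-- **Lagrangian invariance at defect one.**  See the module docstring. [folklore] -/
theorem mulVec_mem_range_of_affine_defect_one {D : Matrix ι' ι' k} (hD : IsUnit D.det) (hDs : Dᵀ = D)
    (bL : (Fin 4 × Fin 4 → k) →ₗ[k] (ι' → k)) (CL : (Fin 4 × Fin 4 → k) →ₗ[k] Matrix ι' ι' k)
    (hCs : ∀ z, (CL z)ᵀ = CL z) {κ : k} (hκ : κ ≠ 0)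
    (hN : ∀ v, bL v = 0 → IsUnit (D + CL v).det ∧ ∀ (z : Fin 4 × Fin 4 → k) (s : k),
      κ * MvPolynomial.eval (v + s • z) (perPoly (Fin 4) k) =
        (Matrix.fromBlocks ((s * 0) • (1 : Matrix Unit Unit k))
          (Matrix.replicateRow Unit (s • bL z)) (Matrix.replicateCol Unit (s • bL z))
          (D + CL v + s • CL z)).det)
    (hdef : Fintype.card ι' ≤ 2 * finrank k (LinearMap.range bL) + 1)
    (v : Fin 4 × Fin 4 → k) (hv : bL v = 0)
    (haff : ∀ z, ∃ e₀ e₁ : k, ∀ s : k,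
      MvPolynomial.eval (z + s • v) (perPoly (Fin 4) k) = e₀ + s * e₁)
    (y : ι' → k) (hy : y ∈ LinearMap.range bL) :
    CL v *ᵥ (D⁻¹ *ᵥ y) ∈ LinearMap.range bL := by
  classical
  have hDis : (D⁻¹)ᵀ = D⁻¹ := by rw [Matrix.transpose_nonsing_inv, hDs]
  have hDiu : IsUnit D⁻¹ :=
    (Matrix.isUnit_iff_isUnit_det _).2 (Matrix.isUnit_nonsing_inv_det_iff.2 hD)
  set B := LinearMap.range bL with hB
  set Sl : (ι' → k) →ₗ[k] (ι' → k) := (CL v * D⁻¹).mulVecLin with hSl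
  have hS : ∀ y, Sl y = CL v *ᵥ (D⁻¹ *ᵥ y) := fun y => by
    rw [hSl, Matrix.mulVecLin_apply, Matrix.mulVec_mulVec]
  -- `S` is self-adjoint for `D⁻¹`
  have hadj : ∀ p q : ι' → k, Sl p ⬝ᵥ D⁻¹ *ᵥ q = p ⬝ᵥ D⁻¹ *ᵥ Sl q := by
    intro p q
    rw [hS, hS, ← dotProduct_mulVec_of_transpose_eq (hCs v),
      ← dotProduct_mulVec_of_transpose_eq hDis]
  -- `D⁻¹ S^n = (D⁻¹ CL v)^n D⁻¹`
  have hT : ∀ (n : ℕ) (q : ι' → k), D⁻¹ *ᵥ (Sl ^ n) q = ((D⁻¹ * CL v) ^ n * D⁻¹) *ᵥ q := by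
    intro n
    induction n with
    | zero => intro q; rw [pow_zero, pow_zero, Module.End.one_apply, Matrix.one_mul]
    | succ n ih =>
      intro q
      rw [pow_succ', Module.End.mul_apply, hS, Matrix.mulVec_mulVec, ih, Matrix.mulVec_mulVec,
        pow_succ']
      simp only [Matrix.mul_assoc]
  -- cyclic isotropy: `⟨S^i b, S^j b'⟩ = 0`
  have hc := fun (z z' : Fin 4 × Fin 4 → k) (n : ℕ) =>
    cyclic_isotropy_of_affine hD hDs bL CL hCs hκ hN v hv haff z z' n
  have hpair : ∀ (i j : ℕ) (z z' : Fin 4 × Fin 4 → k),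
      (Sl ^ i) (bL z) ⬝ᵥ D⁻¹ *ᵥ (Sl ^ j) (bL z') = 0 := by
    intro i
    induction i with
    | zero =>
      intro j z z'
      rw [pow_zero, Module.End.one_apply, hT]
      exact hc z z' j
    | succ i ih =>
      intro j z z'
      rw [pow_succ', Module.End.mul_apply, hadj, ← Module.End.mul_apply, ← pow_succ']
      exact ih (j + 1) z z'
  -- the isotropic space `W = B + S B` has dimension `≤ dim B`, hence equals `B`
  set W : Submodule k (ι' → k) := B ⊔ B.map Sl with hW
  have hWiso : ∀ x ∈ W, x ⬝ᵥ D⁻¹ *ᵥ x = 0 := by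
    intro x hx
    rw [hW, Submodule.mem_sup] at hx
    obtain ⟨_, ⟨z₀, rfl⟩, _, ⟨_, ⟨z₁, rfl⟩, rfl⟩, rfl⟩ := hx
    have e := fun (i j : ℕ) => hpair i j
    have h0 : bL z₀ = (Sl ^ 0) (bL z₀) := by rw [pow_zero, Module.End.one_apply]
    have h1 : Sl (bL z₁) = (Sl ^ 1) (bL z₁) := by rw [pow_one]
    rw [h0, h1]
    simp only [Matrix.mulVec_add, dotProduct_add, add_dotProduct, e, add_zero]
  have hWdim : finrank k W ≤ finrank k B := by
    have h := rank_add_two_mul_finrank_le_of_quadratic_form_eq_zero hDis W hWiso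
    rw [Matrix.rank_of_isUnit _ hDiu] at h
    omega
  have hWB : W = B := (Submodule.eq_of_le_of_finrank_le le_sup_left hWdim).symm
  have hmem : Sl y ∈ W := Submodule.mem_sup_right ⟨y, hy, rfl⟩
  rw [hWB, hS] at hmem
  exact hmem

end Summit.ValiantsHypothesis.ValiantsHypothesis.Theorems.SymPencilLagrangianInvariantDefectOne

end
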